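import Summits.HodgeConjecture.HodgeConjecture.Theorems.K2E3WittCartanTameRamified   -- ★ (K2E3-p09): the tame cone identity §1 (reused) and the (trace)+(norm) theorem (pattern)
import HarnessLib

/-!
# The `hG` letter of the 13a driver for `U(σ, J₀)` with ANY isometric involution and ANY uniformiser, from the RAW Cartan letter `hrawN`
# (crux H413, 13a road A′ — the wildly ramified quasi-split places)

Cell `hodgecm-mathlib`, Track B, line `K2_E3_EllipticInputs`, row 13a; seat K2E3-p10 (g3) (road-A line lead).  THEOREMS ONLY; count-neutral helper
(`--supports stmt-HodgeConjecture-24833 --as helper`).  The mathematics is K2E3-p09 (g3)'s ★ `K2E3WittCartanTameRamified` §2 VERBATIM with the (trace)+(norm)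
Cartan decomposition ★ `exists_cartan_antidiagonal_of_trace_norm` replaced by the LETTER `hrawN` (its conclusion shape at size `N`): `k₁ g k₂ = diag(d)`,
`σ(d_i) d_{rev i} = 1`, `k₁, k₂ ∈ U(σ, J₀)` integral with integral inverses.  At a wildly ramified place `hrawN` is K2E3-p09's «Cartan for any involution»
(★ `K2E3QuasiSplitUnitaryCartanAnyInvolutionStep` + sequel).

* **`exists_unitaryInt_mul_noncommProd_wittCocharacter_mul_of_rawCartan`** — every `g ∈ U(σ, wittFormOn e Han)` (`W = J₀`, `m ≤ 1`, standard `e`) is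
  `k₁ · ∏_α a_α(ϖ)^{n α} · k₂ · 1` with `k₁, k₂ ∈ K₀ = unitaryInt σ W` — the `hG` ∕ `hcartan` binder of ★ p856399 ∕ ★ p856653 with `Ω = K₀`.

References: F. Bruhat, J. Tits (1972), (4.4.3); J. Tits (1979), §3.3.3; W. Casselman (1995), Thm. 5.3.1; R. Jacobowitz (1962), §§7–8.
-/

set_option autoImplicit false
set_option linter.dupNamespace false

open scoped MatrixGroups WithZero
open Matrix

namespace Summit.HodgeConjecture.HodgeConjecture.Cruxes.H413.K2E3WittCartanOfRawCartan

open Literature.NumberTheory.Automorphic Literature.NumberTheory.Automorphic.UnitaryGroup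
open Literature.NumberTheory.Automorphic.HermitianLattice Literature.NumberTheory.Automorphic.CartanUnique
open K2E3LocalUnitaryWitt K2E3WittStandardIndexing K2E3WittConeContraction K2E3WittConeContractionAnyKernel
  K2E3WittCuspidalDichotomyOfCartan K2E3WittCartanUnramified K2E3WittCartanTameRamified

section Cartan

variable {K : Type*} [Field K] (σ : K →+* K) {N r m : ℕ} (e : WittIndex r m ≃ Fin N)
  (hstd : ∀ x, (e x).val = Sum.elim (fun i : Fin r => i.val) (Sum.elim (fun u : Fin m => r + u.val) (fun j : Fin r => r + m + j.val)) x)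
  (hm : m ≤ 1) (Han : Matrix (Fin m) (Fin m) K)

variable [Valued K ℤᵐ⁰]

include hstd hm in
/-- **THE CARTAN DECOMPOSITION OF `U(σ, W)(K)` OVER THE WITT CONE from the raw Cartan letter `hrawN`** (★ K2E3-p09's tame theorem, base replaced) (`W = wittFormOn e Han = J₀`
in a standard indexing, `m ≤ 1`; `ϖ` ANY uniformiser; (trace) + (norm)): every `g ∈ U` is `k₁ · ∏_α a_α(ϖ)^{n α} · k₂ · z` with `k₁, k₂ ∈ K₀ = U ∩ GL_N(𝒪)`
(★ `unitaryInt`), `n : Fin r → ℕ`, `z = 1 ∈ Z(U)` — LITERALLY the `hcartan` binder of ★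
`K2E3WittCuspidalDichotomyOfCartan.isAdmissible_of_subsingleton_coinvariants_of_wittCartan_compact`.  From ★ `exists_cartan_antidiagonal_of_trace_norm`
(`k₁ g k₂ = diag(d)`, `σ(d_i) d_{rev i} = 1`), the `rev`-commuting sort (★ `exists_perm_comm_rev_antitone`) and the splitting `diag(d ∘ τ) = diag(w) · D(b)`
with `D(b) = ∏_α a_α(ϖ)^{n α}` (§1) and `diag(w) ∈ K₀` (★ `diagonalGL_mem_unitaryInt_of_norm`). [cite: BruhatTits1972, (4.4.3)] [cite: Tits1979, §3.3.3] [cite: Casselman1995, Thm. 5.3.1] -/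
theorem exists_unitaryInt_mul_noncommProd_wittCocharacter_mul_of_rawCartan {ϖ : K} (hσ : ∀ x, σ (σ x) = x)
    (hvσ : ∀ x, Valued.v (σ x) = Valued.v x) (hϖ : Valued.v ϖ = WithZero.exp (-1 : ℤ))
    (hrawN : ∀ g : GL (Fin N) K, g ∈ unitaryGroupOfForm σ ((StdForm.antidiagonal N).over K) →
      ∃ k₁ k₂ : GL (Fin N) K, k₁ ∈ unitaryGroupOfForm σ ((StdForm.antidiagonal N).over K) ∧
        (∀ i j, Valued.v ((k₁ : Matrix (Fin N) (Fin N) K) i j) ≤ 1) ∧ (∀ i j, Valued.v (((k₁⁻¹ : GL (Fin N) K) : Matrix (Fin N) (Fin N) K) i j) ≤ 1) ∧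
        k₂ ∈ unitaryGroupOfForm σ ((StdForm.antidiagonal N).over K) ∧
        (∀ i j, Valued.v ((k₂ : Matrix (Fin N) (Fin N) K) i j) ≤ 1) ∧ (∀ i j, Valued.v (((k₂⁻¹ : GL (Fin N) K) : Matrix (Fin N) (Fin N) K) i j) ≤ 1) ∧
        ∃ d : Fin N → K, ((k₁ * g * k₂ : GL (Fin N) K) : Matrix (Fin N) (Fin N) K) = Matrix.diagonal d ∧ ∀ i, σ (d i) * d (Fin.rev i) = 1)
    (hW : wittFormOn e Han = (StdForm.antidiagonal N).over K) (g : ↥(unitaryGroupOfForm σ (wittFormOn e Han))) :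
    ∃ k₁ ∈ unitaryInt σ (wittFormOn e Han), ∃ k₂ ∈ unitaryInt σ (wittFormOn e Han), ∃ n : Fin r → ℕ,
      ∃ z ∈ Subgroup.center ↥(unitaryGroupOfForm σ (wittFormOn e Han)),
        g = k₁ * Finset.univ.noncommProd (fun α => wittCocharacter σ hσ e Han α (Units.mk0 ϖ (uniformizer_ne_zero hϖ)) ^ n α)
          (fun α _ β _ _ => (commute_wittCocharacter σ e hσ Han α β (Units.mk0 ϖ (uniformizer_ne_zero hϖ))
            (Units.mk0 ϖ (uniformizer_ne_zero hϖ))).pow_pow (n α) (n β)) * k₂ * z := by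
  have hϖ0 : ϖ ≠ 0 := uniformizer_ne_zero hϖ
  have hσϖ0 : σ ϖ ≠ 0 := (map_ne_zero σ).2 hϖ0
  have hU : unitaryGroupOfForm σ (wittFormOn e Han) = unitaryGroupOfForm σ ((StdForm.antidiagonal N).over K) := by rw [hW]
  have hgJ : (g : GL (Fin N) K) ∈ unitaryGroupOfForm σ ((StdForm.antidiagonal N).over K) := hU ▸ g.2
  -- the matrix Cartan decomposition `k₁ g k₂ = diag(d)`, `σ(d i) d (rev i) = 1`
  obtain ⟨k₁, k₂, hk₁U, hk₁i, hk₁i', hk₂U, hk₂i, hk₂i', d, hdiag, hdn⟩ :=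
    hrawN (g : GL (Fin N) K) hgJ
  have hd0 : ∀ i, d i ≠ 0 := fun i h0 => by
    have h1 := hdn (Fin.rev i)
    rw [Fin.rev_rev, h0, mul_zero] at h1
    exact zero_ne_one h1
  -- the exponents: `v (d i) = exp (ex i)`, `ex (rev i) = -ex i`; `a := -ex`
  choose ex hex using fun i => exists_v_eq_exp (hd0 i)
  have hexrev : ∀ i, ex (Fin.rev i) = -ex i := fun i => by
    have h1 := congrArg Valued.v (hdn i)
    rw [map_mul, hvσ, map_one, hex, hex, ← WithZero.exp_add, ← WithZero.exp_zero, WithZero.exp_inj] at h1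
    omega
  obtain ⟨a, ha_def⟩ : ∃ a : Fin N → ℤ, a = fun i => -ex i := ⟨_, rfl⟩
  have ha : ∀ i, a (Fin.rev i) = -a i := fun i => by rw [ha_def]; dsimp only; rw [hexrev, neg_neg]
  -- sort inside the relative Weyl group: `b = a ∘ τ` antitone, `b ∘ rev = -b`
  obtain ⟨τ, hτ, hanti, hb⟩ := exists_perm_comm_rev_antitone ha
  set b : Fin N → ℤ := a ∘ τ with hb_def
  -- the cone element and its diagonal `D₀`
  set n : Fin r → ℕ := fun α =>
    ((if h : α.val < r then b (e (Sum.inl ⟨α.val, h⟩)) else 0) - (if h : α.val + 1 < r then b (e (Sum.inl ⟨α.val + 1, h⟩)) else 0)).toNat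
    with hn_def
  set C : ↥(unitaryGroupOfForm σ (wittFormOn e Han)) :=
    Finset.univ.noncommProd (fun α => wittCocharacter σ hσ e Han α (Units.mk0 ϖ hϖ0) ^ n α)
      (fun α _ β _ _ => (commute_wittCocharacter σ e hσ Han α β (Units.mk0 ϖ hϖ0) (Units.mk0 ϖ hϖ0)).pow_pow (n α) (n β)) with hC_def
  set D₀ : Fin N → K := fun k =>
    Sum.elim (fun _ : Fin r => ϖ ^ b k) (Sum.elim (fun _ : Fin m => (1 : K)) (fun _ : Fin r => σ ϖ ^ b k)) (e.symm k) with hD₀_def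
  have hD₀_inl : ∀ i : Fin r, D₀ (e (Sum.inl i)) = ϖ ^ b (e (Sum.inl i)) := fun i => by
    rw [hD₀_def]; dsimp only; rw [e.symm_apply_apply, Sum.elim_inl]
  have hD₀_mid : ∀ u : Fin m, D₀ (e (Sum.inr (Sum.inl u))) = 1 := fun u => by
    rw [hD₀_def]; dsimp only; rw [e.symm_apply_apply, Sum.elim_inr, Sum.elim_inl]
  have hD₀_inr : ∀ j : Fin r, D₀ (e (Sum.inr (Sum.inr j))) = σ ϖ ^ b (e (Sum.inr (Sum.inr j))) := fun j => by
    rw [hD₀_def]; dsimp only; rw [e.symm_apply_apply, Sum.elim_inr, Sum.elim_inr]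
  have hbmid : ∀ u : Fin m, b (e (Sum.inr (Sum.inl u))) = 0 := fun u => exponent_middle_eq_zero e hstd hm hb u
  -- (i) the cone identity: the matrix of `C` is `diag(D₀)`
  have hcone : ∀ k, (∏ α : Fin r, ((wittCoweight σ α (Units.mk0 ϖ hϖ0) (e.symm k) : Kˣ) : K) ^ n α) = D₀ k := by
    intro k
    obtain ⟨x, rfl⟩ := e.surjective k
    rw [e.symm_apply_apply]
    rcases x with i | u | j
    · rw [hD₀_inl]; exact prod_wittCoweight_pow_inl σ e hstd hanti hb hϖ0 i
    · rw [hD₀_mid]; exact prod_wittCoweight_pow_inr_inl σ (Units.mk0 ϖ hϖ0) n u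
    · rw [hD₀_inr]; exact prod_wittCoweight_pow_inr_inr σ e hstd hanti hb hϖ0 j
  have hCmat : (((C : ↥(unitaryGroupOfForm σ (wittFormOn e Han))) : GL (Fin N) K) : Matrix (Fin N) (Fin N) K) = Matrix.diagonal D₀ := by
    rw [hC_def, coe_noncommProd_wittCocharacter_pow]
    exact congrArg Matrix.diagonal (funext hcone)
  -- (ii) `D₀ k ≠ 0`, `v (D₀ k) = exp (-b k)`, `σ(D₀ k) · D₀ (rev k) = 1`
  have hD0 : ∀ k, D₀ k ≠ 0 := by
    intro k
    obtain ⟨x, rfl⟩ := e.surjective k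
    rcases x with i | u | j
    · rw [hD₀_inl]; exact zpow_ne_zero _ hϖ0
    · rw [hD₀_mid]; exact one_ne_zero
    · rw [hD₀_inr]; exact zpow_ne_zero _ hσϖ0
  have hvD : ∀ k, Valued.v (D₀ k) = WithZero.exp (-b k) := by
    intro k
    obtain ⟨x, rfl⟩ := e.surjective k
    rcases x with i | u | j
    · rw [hD₀_inl, v_uniformizer_zpow hϖ]
    · rw [hD₀_mid, map_one, hbmid u, neg_zero, WithZero.exp_zero]
    · rw [hD₀_inr, map_zpow₀, hvσ, ← map_zpow₀, v_uniformizer_zpow hϖ]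
  have hDn : ∀ k, σ (D₀ k) * D₀ (Fin.rev k) = 1 := by
    intro k
    obtain ⟨x, rfl⟩ := e.surjective k
    rcases x with i | u | j
    · rw [hD₀_inl, rev_apply_inl e hstd i, hD₀_inr, ← rev_apply_inl e hstd i, hb, map_zpow₀, ← zpow_add₀ hσϖ0,
        add_neg_cancel, zpow_zero]
    · rw [hD₀_mid, rev_apply_inr_inl e hstd hm u, hD₀_mid, map_one, mul_one]
    · rw [hD₀_inr, rev_apply_inr_inr e hstd j, hD₀_inl, ← rev_apply_inr_inr e hstd j, hb, map_zpow₀, hσ, ← zpow_add₀ hϖ0,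
        add_neg_cancel, zpow_zero]
  -- (iii) the unit diagonal `w = (d ∘ τ) / D₀`
  obtain ⟨w, hw_def⟩ : ∃ w : Fin N → Kˣ, w = fun k => Units.mk0 (d (τ k) / D₀ k) (div_ne_zero (hd0 _) (hD0 k)) := ⟨_, rfl⟩
  have hwval : ∀ k, (w k : K) = d (τ k) / D₀ k := fun k => by rw [hw_def]; rfl
  have hw1 : ∀ k, Valued.v (w k : K) = 1 := fun k => by
    rw [hwval, map_div₀, hex, hvD, hb_def, Function.comp_apply, ha_def]
    dsimp only
    rw [neg_neg, div_self (WithZero.coe_ne_zero)]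
  have hwn : ∀ k, σ (w k) * w (Fin.rev k) = 1 := fun k => by
    rw [hwval, hwval, map_div₀, hτ, div_mul_div_comm, hdn, hDn, div_one]
  -- (iv) the matrix identities in `GL_N(K)`
  obtain ⟨dU, hdU_def⟩ : ∃ dU : Fin N → Kˣ, dU = fun i => Units.mk0 (d i) (hd0 i) := ⟨_, rfl⟩
  have hX : k₁ * (g : GL (Fin N) K) * k₂ = diagonalGL (Fin N) K dU := by
    refine Units.ext ?_
    rw [hdiag, coe_diagonalGL, hdU_def]
    rfl
  have hsplit : diagonalGL (Fin N) K (dU ∘ τ) = diagonalGL (Fin N) K w * (C : GL (Fin N) K) := by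
    refine Units.ext ?_
    rw [Units.val_mul, coe_diagonalGL, coe_diagonalGL, hCmat, Matrix.diagonal_mul_diagonal]
    refine congrArg Matrix.diagonal (funext fun k => ?_)
    rw [Function.comp_apply, hwval, div_mul_cancel₀ _ (hD0 k), hdU_def]
    rfl
  have hgGL : (g : GL (Fin N) K) =
      k₁⁻¹ * (permGL τ)⁻¹ * diagonalGL (Fin N) K w * (C : GL (Fin N) K) * (permGL τ * k₂⁻¹) := by
    have h1 : (g : GL (Fin N) K) = k₁⁻¹ * (k₁ * (g : GL (Fin N) K) * k₂) * k₂⁻¹ := by group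
    have h2 : diagonalGL (Fin N) K dU = (permGL τ)⁻¹ * diagonalGL (Fin N) K (dU ∘ τ) * permGL τ := by
      rw [← permGL_mul_diagonalGL_mul_permGL_inv τ dU]; group
    rw [h1, hX, h2, hsplit]
    simp only [mul_assoc]
  -- (v) the two `K₀`-factors, built in `U(σ, J₀)` and transported along `U(σ, W) = U(σ, J₀)`
  have hK₁ : (⟨k₁, hk₁U⟩ : unitaryGroupOfForm σ ((StdForm.antidiagonal N).over K)) ∈
      unitaryInt σ ((StdForm.antidiagonal N).over K) := mem_unitaryInt_iff.2 ⟨hk₁i, hk₁i'⟩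
  have hK₂ : (⟨k₂, hk₂U⟩ : unitaryGroupOfForm σ ((StdForm.antidiagonal N).over K)) ∈
      unitaryInt σ ((StdForm.antidiagonal N).over K) := mem_unitaryInt_iff.2 ⟨hk₂i, hk₂i'⟩
  have hWmem := diagonalGL_mem_unitaryInt_of_norm (σ := σ) hwn hw1
  have hP := permGL_mem_unitaryInt (K := K) (σ := σ) τ hτ
  set K1 : unitaryGroupOfForm σ ((StdForm.antidiagonal N).over K) :=
    (⟨k₁, hk₁U⟩ : unitaryGroupOfForm σ ((StdForm.antidiagonal N).over K))⁻¹ *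
      (⟨permGL τ, permGL_mem_unitaryGroupOfForm τ hτ⟩ : unitaryGroupOfForm σ ((StdForm.antidiagonal N).over K))⁻¹ *
      ⟨diagonalGL (Fin N) K w, diagonalGL_mem_unitaryGroupOfForm_of_norm hwn⟩ with hK1_def
  set K2 : unitaryGroupOfForm σ ((StdForm.antidiagonal N).over K) :=
    (⟨permGL τ, permGL_mem_unitaryGroupOfForm τ hτ⟩ : unitaryGroupOfForm σ ((StdForm.antidiagonal N).over K)) *
      (⟨k₂, hk₂U⟩ : unitaryGroupOfForm σ ((StdForm.antidiagonal N).over K))⁻¹ with hK2_def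
  have hK1mem : K1 ∈ unitaryInt σ ((StdForm.antidiagonal N).over K) :=
    Subgroup.mul_mem _ (Subgroup.mul_mem _ (Subgroup.inv_mem _ hK₁) (Subgroup.inv_mem _ hP)) hWmem
  have hK2mem : K2 ∈ unitaryInt σ ((StdForm.antidiagonal N).over K) :=
    Subgroup.mul_mem _ hP (Subgroup.inv_mem _ hK₂)
  have hK1val : ((K1 : unitaryGroupOfForm σ ((StdForm.antidiagonal N).over K)) : GL (Fin N) K) =
      k₁⁻¹ * (permGL τ)⁻¹ * diagonalGL (Fin N) K w := rfl
  have hK2val : ((K2 : unitaryGroupOfForm σ ((StdForm.antidiagonal N).over K)) : GL (Fin N) K) = permGL τ * k₂⁻¹ := rfl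
  refine ⟨(MulEquiv.subgroupCongr hU).symm K1, mem_unitaryInt_iff.2 (mem_unitaryInt_iff.1 hK1mem),
    (MulEquiv.subgroupCongr hU).symm K2, mem_unitaryInt_iff.2 (mem_unitaryInt_iff.1 hK2mem), n, 1, Subgroup.one_mem _, ?_⟩
  rw [mul_one]
  refine Subtype.ext ?_
  rw [Subgroup.coe_mul, Subgroup.coe_mul]
  change (g : GL (Fin N) K) = ((K1 : unitaryGroupOfForm σ ((StdForm.antidiagonal N).over K)) : GL (Fin N) K) *
    (C : GL (Fin N) K) * ((K2 : unitaryGroupOfForm σ ((StdForm.antidiagonal N).over K)) : GL (Fin N) K)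
  rw [hK1val, hK2val]
  exact hgGL

end Cartan

end Summit.HodgeConjecture.HodgeConjecture.Cruxes.H413.K2E3WittCartanOfRawCartan
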